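import Literature.AlgebraicGeometry.HodgeTheory.WeilClassesFieldDefiniteQuaternionDichotomy
import Literature.AlgebraicGeometry.HodgeTheory.WeilClassesFieldExceptionalOfCentralTorus
import HarnessLib

/-!
# Moonen–Zarhin's Criterion (2), TYPE 3 WITH `m = 1`, ENTIRELY IN `End(A)`: for `End⁰(A) = D = ℚ(ψ)⟨α, β⟩` a definite
# quaternion algebra, the Weil classes of `F = ℚ(φ)` are decomposable iff `φ` is CENTRAL in `End(A)` («`F ⊆ E`, `E` the
# centre of `D`»), and all non-zero classes are exceptional iff `φ` is not central («`F ⊄ E`») — the centre of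
# `M_ι(ℂ[T] p)` is `ℂ[T]` (Moonen–Zarhin 1998 §1, Criterion (2))

Layer `Literature/AlgebraicGeometry/HodgeTheory`; THEOREMS ONLY — no definition, no named fact, no `sorry` (D-0026, net
debt 0).  Sequel of the seat's `WeilClassesFieldDefiniteQuaternionDichotomy` (g24-#1), which proved «`W_F ⊗ ℂ ≤ 𝒟ᵐ ⊗ ℂ
⟺ φ^* ∈ E ⊗ ℂ = ℂ[ψ^*]`» and «decomposable ⟹ `φ` central in `End(A)`» but left the converse «`φ` central ⟹
`φ^* ∈ ℂ[ψ^*]`» (the algebra of `Z(D) = E`) open.  Here it is closed ON THE CARRIER by Morita theory: on `A¹ = ⨁_{Fin 1} A`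
the seat's `exists_moritaData_cornerForm_adjoint_biproduct_of_definiteQuaternionOver_diagonal` (g23-#4, `n = 0`)
presents the pull-back algebra as `M_ι(ℂ[T] p)` — a Morita datum `(x, y, p)` commuting with `T = (⊕ψ)^*` whose units
`x_s y_t` together with `T` generate an algebra containing `(⊕ψ)^*, (⊕α)^*, (⊕β)^*, (πₐ ≫ ι_b)^*`; §1 proves the purely
algebraic «an element of `ℂ⟨T, x_s y_t⟩` commuting with every unit `x_s y_t` is a polynomial in `T`» (corner normal form
`y_i Φ x_j = f_{ij}(T) p`); a central `φ` has `(⊕φ)^*` commuting with the whole pull-back algebra, hence `(⊕φ)^* ∈ ℂ[T]`,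
and `φ^* ∈ ℂ[ψ^*]` follows by pulling back along the isogeny `π₀ : A¹ ⟶ A`.

## The print

B. J. J. Moonen, Yu. G. Zarhin, *Weil classes on abelian varieties*, J. reine angew. Math. **496** (1998) 83–92 =
arXiv:alg-geom/9612017 [MoonenZarhin1998WeilClasses] (held text `paper:arxiv-alg-geom_9612017`), §1, VERBATIM: «Let
`D = End⁰(Y)`, let `E` be the center of `D` …» (chunk p0002 L46–L47); Criterion (2) (chunk p0003 L59–L69): «… this
last possibility occurs precisely in the following cases: `Y` is of Type 3, `m = 1` and `F ⊄ E`, …»; its proof (chunk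
p0003 L82–L90): «… We claim that, in these cases, `G_div(X)` acts as the identity on `W_F` if and only if `F ⊆ B`.»
J. C. McConnell, J. C. Robson, *Noncommutative Noetherian Rings* [McconnellRobson2001], 3.5.5–3.5.7 (matrix units and
the Morita description `R ≅ M_n(eRe)`).  H. Lange, Ch. Birkenhake [LangeBirkenhake1992], §1.1 (faithfulness of the
rational representation), Ch. 5 §5 (type III).

## What is proved

* §1 (`Literature.LinearAlgebra`, a Morita datum `yᵢ xⱼ = δᵢⱼ p`, `Σ xᵢ yᵢ = 1` commuting with `T`):
  **`exists_corner_eq_aeval_mul_of_mem_adjoin_units`** — for `Φ ∈ ℂ⟨T, x_s y_t⟩` every corner `yᵢ Φ xⱼ` is `f(T) p`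
  for a polynomial `f` (induction on the algebra: generators, sums, products `yᵢ Φ Ψ xⱼ = Σₖ (yᵢ Φ xₖ)(yₖ Ψ xⱼ)`);
  **`mem_adjoin_singleton_of_mem_adjoin_units_of_forall_comm`** — if moreover `Φ` commutes with every unit `x_s y_t`
  then `Φ ∈ ℂ[T]` (the off-diagonal corners vanish, the diagonal ones agree: `Φ = Σᵢ xᵢ f(T) p yᵢ = f(T)`): «the centre
  of `M_ι(ℂ[T] p)` is `ℂ[T]`».
* §2 `pullbackOne_mem_adjoin_singleton_of_biproduct_fin_one` — `(⊕φ)^* ∈ ℂ[(⊕ψ)^*]` on `H¹(A¹)` ⟹ `φ^* ∈ ℂ[ψ^*]` on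
  `H¹(A)` (`π₀^*` is injective and intertwines).
* §3 THE ROW IN `End(A)`: **`pullbackOne_mem_adjoin_singleton_of_forall_comp_comm_of_definiteQuaternionOver_End`** —
  under the type-3 presentation of g23-#5/g24-#1 (`ψ` Rosati-symmetric, `Q(ψ) = 0`; `α, β` Rosati-skew, `ψα = αψ`,
  `ψβ = βψ`, `αβ = -βα`, `α² = a(ψ)`, `β² = b(ψ)`, `a, b` non-vanishing at the roots of `Q`; `hD`: every `g ∈ End(A)`
  has `N g ∈ ℤ⟨ψ, α, β⟩`), a CENTRAL `φ ∈ End(A)` has `φ^* ∈ ℂ[ψ^*]`;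
  **`weilClassesField_le_divisorClassesSpan_iff_forall_comp_comm_of_definiteQuaternionOver_End`** — `W_F ⊗ ℂ ≤ 𝒟ᵐ ⊗ ℂ`
  IFF `g ≫ φ = φ ≫ g` for all `g ∈ End(A)` («`F ⊆ E = Z(D)`»);
  **`weilClassesField_inf_divisorClassesSpan_eq_bot_iff_exists_comp_ne_of_definiteQuaternionOver_End`** —
  `W_F ⊗ ℂ ⊓ 𝒟ᵐ ⊗ ℂ = ⊥` IFF some `g ∈ End(A)` does not commute with `φ` («`Y` is of Type 3, `m = 1` and `F ⊄ E`»).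

## Scope (honest column)

As in g23-#5 / g24-#1: the type-3 structure is the presentation `ψ, α, β` plus `hD`, not Albert's classification; `E` is
read as the CENTRE OF `End(A)` (equivalently of `End⁰(A) = D`), which is how the print defines it («`E` the center of
`D`»); the identification `Z(D) = ℚ(ψ)` as fields is not needed and not proved.  `h` is any class with `h^{dim A} ≠ 0`
and `Q_h` non-degenerate; everything is on `ℂ`-points of Milne's `S(A)(h)`.

## References

* [MoonenZarhin1998WeilClasses] B. J. J. Moonen, Yu. G. Zarhin, Weil classes on abelian varieties, J. reine angew.
  Math. 496 (1998) 83–92; arXiv:alg-geom/9612017: §1 (chunk p0002 L43–L118), Criterion (2) and its proof (chunk p0003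
  L59–L111).
* [McconnellRobson2001] J. C. McConnell, J. C. Robson, Noncommutative Noetherian Rings, GSM 30 (AMS 2001), 3.5.5–3.5.7.
* [Milne1999LefschetzClasses] J. S. Milne, Lefschetz classes on abelian varieties, Duke Math. J. 96 (1999), §1 p. 643,
  Thm. 3.2, Cor. 4.5.
* [LangeBirkenhake1992] H. Lange, Ch. Birkenhake, Complex Abelian Varieties, Grundlehren 302 (1992), §1.1, Ch. 5 §5.

## Provenance

Lane `lit-hodgefound` (Track 2, Layer A), prover seat `lit-hodgefound-p21` (generation 24), row g24-#3 (End-level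
completion of g24-#1).
-/

noncomputable section

open CategoryTheory CategoryTheory.Limits
open Polynomial Module

/-! ### §1 Morita: corners of `ℂ⟨T, x_s y_t⟩` are polynomials in `T`; its centraliser of the units is `ℂ[T]` -/

namespace Literature.LinearAlgebra

section MoritaCentre

variable {M : Type*} [AddCommGroup M] [Module ℂ M] {ι : Type*} [Fintype ι] [DecidableEq ι]
  {x y : ι → Module.End ℂ M} {p T : Module.End ℂ M}

/-- `xᵢ p = xᵢ` for a Morita datum. [folklore] -/
private theorem morita_mul_idem (hyx : ∀ i j, y i * x j = if i = j then p else 0) (hsum : ∑ i, x i * y i = 1)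
    (i : ι) : x i * p = x i := by
  symm
  calc x i = (∑ k, x k * y k) * x i := by rw [hsum, one_mul]
    _ = ∑ k, x k * (y k * x i) := by rw [Finset.sum_mul]; exact Finset.sum_congr rfl fun k _ ↦ mul_assoc _ _ _
    _ = x i * p := by
        rw [Finset.sum_eq_single i (fun k _ hk ↦ by rw [hyx, if_neg hk, mul_zero]) (fun h ↦ absurd (Finset.mem_univ i) h),
          hyx, if_pos rfl]

/-- `p yᵢ = yᵢ` for a Morita datum. [folklore] -/
private theorem morita_idem_mul (hyx : ∀ i j, y i * x j = if i = j then p else 0) (hsum : ∑ i, x i * y i = 1)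
    (i : ι) : p * y i = y i := by
  symm
  calc y i = y i * ∑ k, x k * y k := by rw [hsum, mul_one]
    _ = ∑ k, (y i * x k) * y k := by rw [Finset.mul_sum]; exact Finset.sum_congr rfl fun k _ ↦ (mul_assoc _ _ _).symm
    _ = p * y i := by
        rw [Finset.sum_eq_single i (fun k _ hk ↦ by rw [hyx, if_neg (Ne.symm hk), zero_mul])
          (fun h ↦ absurd (Finset.mem_univ i) h), hyx, if_pos rfl]

/-- `p² = p` for a Morita datum (given an index). [folklore] -/
private theorem morita_idem_sq (hyx : ∀ i j, y i * x j = if i = j then p else 0) (hsum : ∑ i, x i * y i = 1)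
    (i : ι) : p * p = p := by
  have h := hyx i i
  rw [if_pos rfl] at h
  calc p * p = y i * x i * p := by rw [h]
    _ = y i * (x i * p) := mul_assoc _ _ _
    _ = y i * x i := by rw [morita_mul_idem hyx hsum i]
    _ = p := h

omit [Fintype ι] in
/-- `T p = p T` when `T` commutes with the datum. [folklore] -/
private theorem morita_idem_comm (hyx : ∀ i j, y i * x j = if i = j then p else 0)
    (hTx : ∀ i, T * x i = x i * T) (hTy : ∀ i, T * y i = y i * T) (i : ι) : T * p = p * T := by
  have h := hyx i i
  rw [if_pos rfl] at h
  rw [← h, ← mul_assoc, hTy, mul_assoc, hTx, mul_assoc]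

/-- `q(T)` commutes with whatever `T` commutes with. [folklore] -/
private theorem aeval_comm_of_comm' {U : Module.End ℂ M} (hc : T * U = U * T) (q : ℂ[X]) :
    aeval T q * U = U * aeval T q := by
  induction q using Polynomial.induction_on' with
  | add p q hp hq => rw [map_add, add_mul, mul_add, hp, hq]
  | monomial k c =>
    rw [aeval_monomial, mul_assoc, Algebra.algebraMap_eq_smul_one, smul_mul_assoc, one_mul, smul_mul_assoc, one_mul,
      mul_smul_comm]
    congr 1
    induction k with
    | zero => rw [pow_zero, one_mul, mul_one]
    | succ k ih => rw [pow_succ, mul_assoc, hc, ← mul_assoc, ih, mul_assoc]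

/-- **THE CORNERS OF `ℂ⟨T, x_s y_t⟩` ARE POLYNOMIALS IN `T`.**  Let `(x, y, p)` be a Morita datum on `M`
(`yᵢ xⱼ = δᵢⱼ p`, `Σᵢ xᵢ yᵢ = 1`) commuting with `T`.  For every `Φ` in the `ℂ`-algebra generated by `T` and the units
`x_s y_t`, and all `i, j`, there is a polynomial `f` with `yᵢ Φ xⱼ = f(T) p`: the Morita description `R = M_ι(p R p)`
with corner ring `p ℂ⟨T, x_s y_t⟩ p = ℂ[T] p` (on generators `yᵢ T xⱼ = δᵢⱼ T p`, `yᵢ x_s y_t xⱼ = δᵢₛ δₜⱼ p`; products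
by `yᵢ Φ Ψ xⱼ = Σₖ (yᵢ Φ xₖ)(yₖ Ψ xⱼ)`). [cite: McconnellRobson2001, 3.5.5–3.5.7 (matrix units; R ≅ M_n(eRe))] -/
theorem exists_corner_eq_aeval_mul_of_mem_adjoin_units (hyx : ∀ i j, y i * x j = if i = j then p else 0)
    (hsum : ∑ i, x i * y i = 1) (hTx : ∀ i, T * x i = x i * T) (hTy : ∀ i, T * y i = y i * T)
    {Φ : Module.End ℂ M} (hΦ : Φ ∈ Algebra.adjoin ℂ (insert T (Set.range fun st : ι × ι ↦ x st.1 * y st.2)))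
    (i j : ι) : ∃ f : ℂ[X], y i * Φ * x j = aeval T f * p := by
  classical
  induction hΦ using Algebra.adjoin_induction generalizing i j with
  | mem z hz =>
    rcases hz with rfl | ⟨st, rfl⟩
    · refine ⟨if i = j then X else 0, ?_⟩
      rw [show y i * z = z * y i from (hTy i).symm, mul_assoc, hyx]
      split_ifs with hij
      · rw [aeval_X]
      · rw [mul_zero, map_zero, zero_mul]
    · obtain ⟨s, t⟩ := st
      have hp2 : p * p = p := morita_idem_sq hyx hsum i
      refine ⟨if i = s ∧ t = j then 1 else 0, ?_⟩
      change y i * (x s * y t) * x j = _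
      rw [← mul_assoc, hyx, mul_assoc, hyx]
      by_cases h1 : i = s <;> by_cases h2 : t = j <;> simp [h1, h2, hp2]
  | algebraMap r =>
    refine ⟨if i = j then C r else 0, ?_⟩
    rw [Algebra.algebraMap_eq_smul_one, mul_smul_comm, mul_one, smul_mul_assoc, hyx]
    split_ifs with hij
    · rw [aeval_C, Algebra.algebraMap_eq_smul_one, smul_mul_assoc, one_mul]
    · rw [smul_zero, map_zero, zero_mul]
  | add Φ Ψ _ _ hΦ hΨ =>
    obtain ⟨f, hf⟩ := hΦ i j
    obtain ⟨g, hg⟩ := hΨ i j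
    refine ⟨f + g, ?_⟩
    rw [mul_add, add_mul, hf, hg, map_add, add_mul]
  | mul Φ Ψ _ _ hΦ hΨ =>
    choose f hf using fun k ↦ hΦ i k
    choose g hg using fun k ↦ hΨ k j
    refine ⟨∑ k, f k * g k, ?_⟩
    have hpT : T * p = p * T := morita_idem_comm hyx hTx hTy i
    calc y i * (Φ * Ψ) * x j = y i * Φ * (∑ k, x k * y k) * Ψ * x j := by rw [hsum, mul_one]; simp only [mul_assoc]
      _ = ∑ k, (y i * Φ * x k) * (y k * Ψ * x j) := by
          rw [Finset.mul_sum, Finset.sum_mul, Finset.sum_mul]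
          exact Finset.sum_congr rfl fun k _ ↦ by simp only [mul_assoc]
      _ = ∑ k, aeval T (f k * g k) * p := by
          refine Finset.sum_congr rfl fun k _ ↦ ?_
          rw [hf k, hg k, map_mul, mul_assoc, ← mul_assoc p, ← aeval_comm_of_comm' hpT (g k), mul_assoc,
            morita_idem_sq hyx hsum i, ← mul_assoc]
      _ = aeval T (∑ k, f k * g k) * p := by rw [map_sum, Finset.sum_mul]

/-- **THE CENTRALISER OF THE UNITS IN `ℂ⟨T, x_s y_t⟩` IS `ℂ[T]`.**  If `Φ ∈ ℂ⟨T, x_s y_t⟩` commutes with every unit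
`x_s y_t` of a Morita datum commuting with `T`, then `Φ` is a polynomial in `T`: the off-diagonal corners `yᵢ Φ xⱼ`
(`i ≠ j`) vanish, the diagonal ones coincide (`yᵢ Φ xᵢ = y_{i₀} Φ x_{i₀} = f(T) p`), and `Φ = Σᵢ xᵢ (yᵢ Φ xᵢ) yᵢ =
f(T) Σᵢ xᵢ p yᵢ = f(T)`.  «The centre of `M_ι(S)` is the centre of `S`», here `S = ℂ[T] p`.
[cite: McconnellRobson2001, 3.5.5–3.5.7] -/
theorem mem_adjoin_singleton_of_mem_adjoin_units_of_forall_comm (hyx : ∀ i j, y i * x j = if i = j then p else 0)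
    (hsum : ∑ i, x i * y i = 1) (hTx : ∀ i, T * x i = x i * T) (hTy : ∀ i, T * y i = y i * T)
    {Φ : Module.End ℂ M} (hΦ : Φ ∈ Algebra.adjoin ℂ (insert T (Set.range fun st : ι × ι ↦ x st.1 * y st.2)))
    (hcomm : ∀ s t, Φ * (x s * y t) = x s * y t * Φ) :
    Φ ∈ Algebra.adjoin ℂ ({T} : Set (Module.End ℂ M)) := by
  classical
  rcases isEmpty_or_nonempty ι with hι | ⟨⟨i₀⟩⟩
  · have h1 : (1 : Module.End ℂ M) = 0 := by rw [← hsum]; exact Fintype.sum_empty _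
    have hΦ0 : Φ = 0 := by rw [← mul_one Φ, h1, mul_zero]
    rw [hΦ0]
    exact Subalgebra.zero_mem _
  obtain ⟨f, hf⟩ := exists_corner_eq_aeval_mul_of_mem_adjoin_units hyx hsum hTx hTy hΦ i₀ i₀
  -- diagonal corners agree, off-diagonal corners vanish
  have hdiag : ∀ i, y i * Φ * x i = aeval T f * p := by
    intro i
    rw [← hf]
    calc y i * Φ * x i = y i * Φ * (x i * y i₀ * x i₀) := by
            rw [mul_assoc (x i), hyx, if_pos rfl, morita_mul_idem hyx hsum i]
      _ = y i * (Φ * (x i * y i₀)) * x i₀ := by simp only [mul_assoc]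
      _ = y i * (x i * y i₀ * Φ) * x i₀ := by rw [hcomm]
      _ = (y i * x i) * y i₀ * Φ * x i₀ := by simp only [mul_assoc]
      _ = y i₀ * Φ * x i₀ := by rw [hyx, if_pos rfl, morita_idem_mul hyx hsum i₀]
  have hoff : ∀ i j, i ≠ j → y i * Φ * x j = 0 := by
    intro i j hij
    calc y i * Φ * x j = y i * Φ * (x j * y j * x j) := by
            rw [mul_assoc (x j), hyx, if_pos rfl, morita_mul_idem hyx hsum j]
      _ = y i * (Φ * (x j * y j)) * x j := by simp only [mul_assoc]
      _ = y i * (x j * y j * Φ) * x j := by rw [hcomm]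
      _ = (y i * x j) * y j * Φ * x j := by simp only [mul_assoc]
      _ = 0 := by rw [hyx, if_neg hij, zero_mul, zero_mul, zero_mul]
  have hpT : T * p = p * T := morita_idem_comm hyx hTx hTy i₀
  have hΦ' : Φ = aeval T f := by
    calc Φ = (∑ i, x i * y i) * Φ * ∑ j, x j * y j := by rw [hsum, one_mul, mul_one]
      _ = ∑ i, ∑ j, x i * (y i * Φ * x j) * y j := by
          rw [Finset.sum_mul, Finset.sum_mul]
          refine Finset.sum_congr rfl fun i _ ↦ ?_
          rw [Finset.mul_sum]
          exact Finset.sum_congr rfl fun j _ ↦ by simp only [mul_assoc]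
      _ = ∑ i, x i * (aeval T f * p) * y i := by
          refine Finset.sum_congr rfl fun i _ ↦ ?_
          rw [Finset.sum_eq_single i (fun j _ hji ↦ by rw [hoff i j (Ne.symm hji), mul_zero, zero_mul])
            (fun h ↦ absurd (Finset.mem_univ i) h), hdiag i]
      _ = ∑ i, aeval T f * (x i * y i) := by
          refine Finset.sum_congr rfl fun i _ ↦ ?_
          calc x i * (aeval T f * p) * y i = (x i * aeval T f) * (p * y i) := by simp only [mul_assoc]
            _ = (aeval T f * x i) * y i := by rw [← aeval_comm_of_comm' (hTx i) f, morita_idem_mul hyx hsum i]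
            _ = aeval T f * (x i * y i) := mul_assoc _ _ _
      _ = aeval T f := by rw [← Finset.mul_sum, hsum, mul_one]
  rw [hΦ']
  exact Polynomial.aeval_mem_adjoin_singleton _ _

end MoritaCentre

end Literature.LinearAlgebra

/-! ### §2 From `A¹ = ⨁_{Fin 1} A` back to `A`: polynomials in `(⊕ψ)^*` pull back to polynomials in `ψ^*` -/

namespace Literature.AlgebraicGeometry.HodgeTheory

open Literature.AlgebraicTopology.SingularHomology
open Literature.AlgebraicGeometry.Motives
open Literature.AlgebraicGeometry.VanGeemen1994 (hodgeClassSpan pullbackOne)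
open Literature.AlgebraicGeometry.Milne1999
open Literature.Geometry.Kaehler (lefschetzPow)
open Literature.Barriers.HodgeConjecture (divisorClassesSpan)
open Literature.LinearAlgebra

section PowerOne

variable {A : AbelianVariety ℂ}

/-- `L ∘ q(S) = q(T) ∘ L` when `L ∘ S = T ∘ L`. [folklore] -/
private theorem map_aeval_apply_of_semiconj' {M N : Type*} [AddCommGroup M] [Module ℂ M] [AddCommGroup N] [Module ℂ N]
    (L : M →ₗ[ℂ] N) (S : Module.End ℂ M) (T : Module.End ℂ N) (hc : ∀ v, L (S v) = T (L v)) (q : ℂ[X]) (v : M) :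
    L (aeval S q v) = aeval T q (L v) := by
  induction q using Polynomial.induction_on' generalizing v with
  | add p q hp hq => rw [map_add, map_add, LinearMap.add_apply, LinearMap.add_apply, map_add, hp, hq]
  | monomial k c =>
    rw [aeval_monomial, aeval_monomial, Module.End.mul_apply, Module.End.mul_apply,
      Module.algebraMap_end_apply, Module.algebraMap_end_apply, map_smul]
    congr 1
    induction k generalizing v with
    | zero => rw [pow_zero, pow_zero, Module.End.one_apply, Module.End.one_apply]
    | succ k ih => rw [pow_succ, pow_succ, Module.End.mul_apply, Module.End.mul_apply, ih, hc]

/-- **`(⊕φ)^* ∈ ℂ[(⊕ψ)^*]` on `H¹(A¹)` ⟹ `φ^* ∈ ℂ[ψ^*]` on `H¹(A)`**: `π₀^* : H¹(A) → H¹(A¹)` is injective (an isogeny)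
and intertwines `φ^*` with `(⊕φ)^*`, `ψ^*` with `(⊕ψ)^*`, hence `f(ψ^*)` with `f((⊕ψ)^*)`.
[cite: MoonenZarhin1998WeilClasses, §1 («everything only depends on X up to isogeny», chunk p0002 L45–L46)] [cite: LangeBirkenhake1992, §1.1] -/
theorem pullbackOne_mem_adjoin_singleton_of_biproduct_fin_one {φ ψ : A ⟶ A}
    (hmem : pullbackOne (⨁ (fun _ : Fin (0 + 1) => A)) (biproduct.map fun _ : Fin (0 + 1) => φ) ∈ Algebra.adjoin ℂ
      ({pullbackOne (⨁ (fun _ : Fin (0 + 1) => A)) (biproduct.map fun _ : Fin (0 + 1) => ψ)} :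
        Set (Module.End ℂ (complexBetti (⨁ (fun _ : Fin (0 + 1) => A)).X 1)))) :
    pullbackOne A φ ∈ Algebra.adjoin ℂ ({pullbackOne A ψ} : Set (Module.End ℂ (complexBetti A.X 1))) := by
  rw [Algebra.adjoin_singleton_eq_range_aeval] at hmem
  obtain ⟨f, hf⟩ := hmem
  have hf' : aeval (pullbackOne (⨁ (fun _ : Fin (0 + 1) => A)) (biproduct.map fun _ : Fin (0 + 1) => ψ)) f =
      pullbackOne (⨁ (fun _ : Fin (0 + 1) => A)) (biproduct.map fun _ : Fin (0 + 1) => φ) := hf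
  have hfi := isIsogeny_biproduct_π_fin_one (A := A)
  have hinj := (complexBetti_map_bijective_of_isIsogeny hfi 1).1
  have hcφ : biproduct.π (fun _ : Fin (0 + 1) => A) 0 ≫ φ =
      (biproduct.map fun _ : Fin (0 + 1) => φ) ≫ biproduct.π (fun _ : Fin (0 + 1) => A) 0 :=
    (biproduct.map_π (fun _ : Fin (0 + 1) => φ) 0).symm
  have hcψ : biproduct.π (fun _ : Fin (0 + 1) => A) 0 ≫ ψ =
      (biproduct.map fun _ : Fin (0 + 1) => ψ) ≫ biproduct.π (fun _ : Fin (0 + 1) => A) 0 :=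
    (biproduct.map_π (fun _ : Fin (0 + 1) => ψ) 0).symm
  set L : complexBetti A.X 1 →ₗ[ℂ] complexBetti (⨁ (fun _ : Fin (0 + 1) => A)).X 1 :=
    (complexBetti.map (biproduct.π (fun _ : Fin (0 + 1) => A) 0).hom.hom.hom 1).hom with hLdef
  have hLφ : ∀ v, L (pullbackOne A φ v) = pullbackOne (⨁ (fun _ : Fin (0 + 1) => A))
      (biproduct.map fun _ : Fin (0 + 1) => φ) (L v) := fun v ↦ complexBetti_map_map_of_comm hcφ 1 v
  have hLψ : ∀ v, L (pullbackOne A ψ v) = pullbackOne (⨁ (fun _ : Fin (0 + 1) => A))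
      (biproduct.map fun _ : Fin (0 + 1) => ψ) (L v) := fun v ↦ complexBetti_map_map_of_comm hcψ 1 v
  have hφf : pullbackOne A φ = aeval (pullbackOne A ψ) f := by
    refine LinearMap.ext fun v ↦ hinj ?_
    change L (pullbackOne A φ v) = L (aeval (pullbackOne A ψ) f v)
    rw [hLφ, map_aeval_apply_of_semiconj' L (pullbackOne A ψ) _ hLψ f v, hf']
  rw [hφf]
  exact Polynomial.aeval_mem_adjoin_singleton _ _

end PowerOne

/-! ### §3 THE TYPE-3 ROW WITH `m = 1` IN `End(A)`: decomposable ⟺ `φ` central, all exceptional ⟺ `φ` not central -/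

section Central

variable {A : AbelianVariety ℂ} {h : complexBetti A.X 2} {ψ α β φ : A ⟶ A} {P Q qa qb : Polynomial ℤ} {e m : ℕ}

/-- **A CENTRAL `φ ∈ End(A)` HAS `φ^* ∈ E ⊗ ℂ = ℂ[ψ^*]`** («`Z(D) = E`» on the carrier).  Under the type-3 presentation
of `End⁰(A) = D = ℚ(ψ)⟨α, β⟩` (`ψ` Rosati-symmetric, `Q(ψ) = 0`; `α, β` Rosati-skew, commuting with `ψ`, anticommuting,
`α² = a(ψ)`, `β² = b(ψ)` with `a, b` non-vanishing at the roots of `Q`; every `g ∈ End(A)` with a non-zero multiple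
in `ℤ⟨ψ, α, β⟩`; `h ∈ B¹ ⊗ ℂ`, `h^{dim A} ≠ 0`, `Q_h` non-degenerate): if `g ≫ φ = φ ≫ g` for all `g ∈ End(A)`, then
`φ^*` is a complex polynomial in `ψ^*`.  Proof: on `A¹` the pull-back algebra is `M_ι(ℂ[T] p)` for the Morita datum of
`exists_moritaData_cornerForm_adjoint_biproduct_of_definiteQuaternionOver_diagonal` (`n = 0`); `(⊕φ)^*` lies in it
(`hD`) and commutes with its units (centrality), so `(⊕φ)^* ∈ ℂ[(⊕ψ)^*]` by §1, and §2 pulls this back to `A`.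
[cite: MoonenZarhin1998WeilClasses, §1 («E the center of D»; Criterion (2), type 3 with m = 1; chunk p0002 L46–L47, p0003 L59–L90)]
[cite: McconnellRobson2001, 3.5.5–3.5.7] [cite: LangeBirkenhake1992, §1.1, Ch. 5 §5 (PDF p. 138)] -/
theorem pullbackOne_mem_adjoin_singleton_of_forall_comp_comm_of_definiteQuaternionOver_End
    (hA : 0 < A.dim) (hh : h ∈ hodgeClassSpan A.dim A.X 1) (htop : lefschetzPow h (A.dim - 1) 2 h ≠ 0)
    (hnd : ∀ x : complexBetti A.X 1, (∀ y, polarizationPairingOne A.X h (A.dim - 1) x y = 0) → x = 0)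
    (hψsym : ∀ v w : complexBetti A.X 1, polarizationPairingOne A.X h (A.dim - 1) (pullbackOne A ψ v) w =
      polarizationPairingOne A.X h (A.dim - 1) v (pullbackOne A ψ w))
    (hQm : Q.Monic) (hQirr : Irreducible (Q.map (Int.castRingHom ℚ)))
    (hψQ : Polynomial.eval₂ (Int.castRingHom (CategoryTheory.End A)) (ψ : CategoryTheory.End A) Q = 0)
    (hα2 : α ≫ α = Polynomial.eval₂ (Int.castRingHom (CategoryTheory.End A)) (ψ : CategoryTheory.End A) qa)
    (hqa : ∀ z : ℂ, (Q.map (Int.castRingHom ℂ)).IsRoot z → (qa.map (Int.castRingHom ℂ)).eval z ≠ 0)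
    (hβ2 : β ≫ β = Polynomial.eval₂ (Int.castRingHom (CategoryTheory.End A)) (ψ : CategoryTheory.End A) qb)
    (hqb : ∀ z : ℂ, (Q.map (Int.castRingHom ℂ)).IsRoot z → (qb.map (Int.castRingHom ℂ)).eval z ≠ 0)
    (hanti : α ≫ β = -(β ≫ α))
    (hαskew : ∀ v w : complexBetti A.X 1, polarizationPairingOne A.X h (A.dim - 1) (pullbackOne A α v) w =
      -polarizationPairingOne A.X h (A.dim - 1) v (pullbackOne A α w))
    (hβskew : ∀ v w : complexBetti A.X 1, polarizationPairingOne A.X h (A.dim - 1) (pullbackOne A β v) w =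
      -polarizationPairingOne A.X h (A.dim - 1) v (pullbackOne A β w))
    (hψα : ψ ≫ α = α ≫ ψ) (hψβ : ψ ≫ β = β ≫ ψ)
    (hD : ∀ g : A ⟶ A, ∃ N : ℤ, N ≠ 0 ∧ End.of (N • g) ∈ Subring.closure {End.of ψ, End.of α, End.of β})
    (hφc : ∀ g : A ⟶ A, g ≫ φ = φ ≫ g) :
    pullbackOne A φ ∈ Algebra.adjoin ℂ ({pullbackOne A ψ} : Set (Module.End ℂ (complexBetti A.X 1))) := by
  classical
  -- the carrier form of the presentation
  have hα2' : pullbackOne A α * pullbackOne A α = aeval (pullbackOne A ψ) (qa.map (Int.castRingHom ℂ)) := by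
    rw [← pullbackOne_comp_eq_mul, hα2]
    exact pullbackOne_eval₂ ψ qa
  have hβ2' : pullbackOne A β * pullbackOne A β = aeval (pullbackOne A ψ) (qb.map (Int.castRingHom ℂ)) := by
    rw [← pullbackOne_comp_eq_mul, hβ2]
    exact pullbackOne_eval₂ ψ qb
  have hanti' : pullbackOne A α * pullbackOne A β = -(pullbackOne A β * pullbackOne A α) := by
    rw [← pullbackOne_comp_eq_mul, hanti, pullbackOne_neg_eq_neg, pullbackOne_comp_eq_mul]
  have hψα' : pullbackOne A ψ * pullbackOne A α = pullbackOne A α * pullbackOne A ψ := by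
    rw [← pullbackOne_comp_eq_mul, hψα, pullbackOne_comp_eq_mul]
  have hψβ' : pullbackOne A ψ * pullbackOne A β = pullbackOne A β * pullbackOne A ψ := by
    rw [← pullbackOne_comp_eq_mul, hψβ, pullbackOne_comp_eq_mul]
  -- the Morita datum of `D ⊗ ℂ` on `H¹(A¹)`
  obtain ⟨t, p, x, y, σ, ε, hyx, hsum, -, -, -, -, -, hTx, hTy, -, hx𝔄, hy𝔄, -, hgen, -, -⟩ :=
    exists_moritaData_cornerForm_adjoint_biproduct_of_definiteQuaternionOver_diagonal (n := 0) hA hh htop hnd hψsym hQm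
      hQirr hψQ hα2' hqa hβ2' hqb hanti' hαskew hβskew hψα' hψβ'
  -- `(⊕φ)^*` lies in `ℂ⟨T, x_s y_t⟩` («End⁰(A) = D») …
  have hmemD := pullbackOne_mem_adjoin_diagonal_of_forall_exists_zsmul_mem_closure_triple (n := 0) hD
    (biproduct.map fun _ : Fin (0 + 1) => φ)
  have hmem : pullbackOne (⨁ (fun _ : Fin (0 + 1) => A)) (biproduct.map fun _ : Fin (0 + 1) => φ) ∈ Algebra.adjoin ℂ
      (insert (pullbackOne (⨁ (fun _ : Fin (0 + 1) => A)) (biproduct.map fun _ : Fin (0 + 1) => ψ))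
        (Set.range fun st : (Fin (0 + 1) × Fin 2) × (Fin (0 + 1) × Fin 2) ↦ x st.1 * y st.2)) :=
    Algebra.adjoin_le hgen hmemD
  -- … and commutes with its units (`φ` central ⟹ `(⊕φ)` central ⟹ `(⊕φ)^*` commutes with the pull-back algebra)
  have hφc' : ∀ g : A ⟶ A, φ ≫ g = g ≫ φ := fun g ↦ (hφc g).symm
  have hcent : ∀ z ∈ Algebra.adjoin ℂ (Set.range fun χ : (⨁ (fun _ : Fin (0 + 1) => A)) ⟶ (⨁ (fun _ : Fin (0 + 1) => A)) ↦
      pullbackOne (⨁ (fun _ : Fin (0 + 1) => A)) χ),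
      z * pullbackOne (⨁ (fun _ : Fin (0 + 1) => A)) (biproduct.map fun _ : Fin (0 + 1) => φ) =
        pullbackOne (⨁ (fun _ : Fin (0 + 1) => A)) (biproduct.map fun _ : Fin (0 + 1) => φ) * z := by
    intro z hz
    have hgens : (Set.range fun χ : (⨁ (fun _ : Fin (0 + 1) => A)) ⟶ (⨁ (fun _ : Fin (0 + 1) => A)) ↦
        pullbackOne (⨁ (fun _ : Fin (0 + 1) => A)) χ) ⊆
        (Subalgebra.centralizer ℂ ({pullbackOne (⨁ (fun _ : Fin (0 + 1) => A))
          (biproduct.map fun _ : Fin (0 + 1) => φ)} : Set _) : Set _) := by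
      rintro _ ⟨χ, rfl⟩
      rw [SetLike.mem_coe, Subalgebra.mem_centralizer_iff]
      intro w hw
      rw [Set.mem_singleton_iff.1 hw, ← pullbackOne_comp_eq_mul, ← pullbackOne_comp_eq_mul,
        biproductMap_const_comm_of_forall_comm hφc' χ]
    have h1 := Algebra.adjoin_le hgens hz
    rw [Subalgebra.mem_centralizer_iff] at h1
    exact (h1 _ (Set.mem_singleton _)).symm
  have hcomm : ∀ s t', pullbackOne (⨁ (fun _ : Fin (0 + 1) => A)) (biproduct.map fun _ : Fin (0 + 1) => φ) * (x s * y t') =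
      x s * y t' * pullbackOne (⨁ (fun _ : Fin (0 + 1) => A)) (biproduct.map fun _ : Fin (0 + 1) => φ) :=
    fun s t' ↦ (hcent _ (Subalgebra.mul_mem _ (hx𝔄 s) (hy𝔄 t'))).symm
  -- §1: `(⊕φ)^* ∈ ℂ[T]`; §2: back to `A`
  exact pullbackOne_mem_adjoin_singleton_of_biproduct_fin_one
    (mem_adjoin_singleton_of_mem_adjoin_units_of_forall_comm hyx hsum hTx hTy hmem hcomm)

/-- **MOONEN–ZARHIN's CRITERION (2), TYPE 3 WITH `m = 1`, IN `End(A)` — `W_F` DECOMPOSABLE IFF `φ` IS CENTRAL**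
(«`G_div(X)` acts as the identity on `W_F` if and only if `F ⊆ B`», `B = E` the centre of `D`): under the type-3
presentation of `End⁰(A)` (as in g24-#1) and for `φ ∈ End(A)` with `P(φ) = 0`, `e · 2m = 2 dim A`:
`W_F ⊗ ℂ ≤ 𝒟ᵐ ⊗ ℂ ↔ ∀ g ∈ End(A), g ≫ φ = φ ≫ g`.  «⟹» is g24-#1's
`comp_comm_of_weilClassesField_le_divisorClassesSpan_of_definiteQuaternionOver_End`; «⟸» is the theorem above
followed by g24-#1's «`φ^* ∈ ℂ[ψ^*]` ⟹ decomposable».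
[cite: MoonenZarhin1998WeilClasses, §1 Criterion (2), case «Y is of Type 3, m = 1 and F ⊄ E» and its proof (chunk p0003 L59–L90)]
[cite: Milne1999LefschetzClasses, §1 p. 643, Thm. 3.2, Cor. 4.5] [cite: LangeBirkenhake1992, §1.1, Ch. 5 §5 (PDF p. 138)] -/
theorem weilClassesField_le_divisorClassesSpan_iff_forall_comp_comm_of_definiteQuaternionOver_End
    (hA : 0 < A.dim) (hh : h ∈ hodgeClassSpan A.dim A.X 1) (htop : lefschetzPow h (A.dim - 1) 2 h ≠ 0)
    (hnd : ∀ x : complexBetti A.X 1, (∀ y, polarizationPairingOne A.X h (A.dim - 1) x y = 0) → x = 0)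
    (hψsym : ∀ v w : complexBetti A.X 1, polarizationPairingOne A.X h (A.dim - 1) (pullbackOne A ψ v) w =
      polarizationPairingOne A.X h (A.dim - 1) v (pullbackOne A ψ w))
    (hQm : Q.Monic) (hQirr : Irreducible (Q.map (Int.castRingHom ℚ)))
    (hψQ : Polynomial.eval₂ (Int.castRingHom (CategoryTheory.End A)) (ψ : CategoryTheory.End A) Q = 0)
    (hα2 : α ≫ α = Polynomial.eval₂ (Int.castRingHom (CategoryTheory.End A)) (ψ : CategoryTheory.End A) qa)
    (hqa : ∀ z : ℂ, (Q.map (Int.castRingHom ℂ)).IsRoot z → (qa.map (Int.castRingHom ℂ)).eval z ≠ 0)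
    (hβ2 : β ≫ β = Polynomial.eval₂ (Int.castRingHom (CategoryTheory.End A)) (ψ : CategoryTheory.End A) qb)
    (hqb : ∀ z : ℂ, (Q.map (Int.castRingHom ℂ)).IsRoot z → (qb.map (Int.castRingHom ℂ)).eval z ≠ 0)
    (hanti : α ≫ β = -(β ≫ α))
    (hαskew : ∀ v w : complexBetti A.X 1, polarizationPairingOne A.X h (A.dim - 1) (pullbackOne A α v) w =
      -polarizationPairingOne A.X h (A.dim - 1) v (pullbackOne A α w))
    (hβskew : ∀ v w : complexBetti A.X 1, polarizationPairingOne A.X h (A.dim - 1) (pullbackOne A β v) w =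
      -polarizationPairingOne A.X h (A.dim - 1) v (pullbackOne A β w))
    (hψα : ψ ≫ α = α ≫ ψ) (hψβ : ψ ≫ β = β ≫ ψ)
    (hD : ∀ g : A ⟶ A, ∃ N : ℤ, N ≠ 0 ∧ End.of (N • g) ∈ Subring.closure {End.of ψ, End.of α, End.of β})
    (hPm : P.Monic) (hPe : P.natDegree = e) (hPirr : Irreducible (P.map (Int.castRingHom ℚ)))
    (hφ : Polynomial.eval₂ (Int.castRingHom (CategoryTheory.End A)) (φ : CategoryTheory.End A) P = 0)
    (her : e * (2 * m) = 2 * A.dim) :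
    weilClassesField A φ P (2 * m) ≤ divisorClassesSpan A.X A.dim m ↔ ∀ g : A ⟶ A, g ≫ φ = φ ≫ g := by
  refine ⟨fun hle g ↦ comp_comm_of_weilClassesField_le_divisorClassesSpan_of_definiteQuaternionOver_End hA hh htop hnd
    hψsym hQm hQirr hψQ hα2 hqa hβ2 hqb hanti hαskew hβskew hψα hψβ hD hPm hPe hPirr hφ her hle g, fun hφc ↦ ?_⟩
  exact (weilClassesField_le_divisorClassesSpan_iff_mem_adjoin_singleton_of_definiteQuaternionOver_End hA hh htop hnd hψsym
    hQm hQirr hψQ hα2 hqa hβ2 hqb hanti hαskew hβskew hψα hψβ hD hPm hPe hPirr hφ her).2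
    (pullbackOne_mem_adjoin_singleton_of_forall_comp_comm_of_definiteQuaternionOver_End hA hh htop hnd hψsym hQm hQirr hψQ
      hα2 hqa hβ2 hqb hanti hαskew hβskew hψα hψβ hD hφc)

/-- **… AND ALL NON-ZERO WEIL CLASSES ARE EXCEPTIONAL IFF `φ` IS NOT CENTRAL** («`Y` is of Type 3, `m = 1` and
`F ⊄ E`», `E = Z(D)`): `W_F ⊗ ℂ ⊓ 𝒟ᵐ ⊗ ℂ = ⊥ ↔ ∃ g ∈ End(A), g ≫ φ ≠ φ ≫ g`.
[cite: MoonenZarhin1998WeilClasses, §1 Criterion (2), case «Y is of Type 3, m = 1 and F ⊄ E» and its proof (chunk p0003 L59–L90)]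
[cite: Milne1999LefschetzClasses, §1 p. 643, Thm. 3.2, Cor. 4.5] [cite: LangeBirkenhake1992, §1.1, Ch. 5 §5 (PDF p. 138)] -/
theorem weilClassesField_inf_divisorClassesSpan_eq_bot_iff_exists_comp_ne_of_definiteQuaternionOver_End
    (hA : 0 < A.dim) (hh : h ∈ hodgeClassSpan A.dim A.X 1) (htop : lefschetzPow h (A.dim - 1) 2 h ≠ 0)
    (hnd : ∀ x : complexBetti A.X 1, (∀ y, polarizationPairingOne A.X h (A.dim - 1) x y = 0) → x = 0)
    (hψsym : ∀ v w : complexBetti A.X 1, polarizationPairingOne A.X h (A.dim - 1) (pullbackOne A ψ v) w =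
      polarizationPairingOne A.X h (A.dim - 1) v (pullbackOne A ψ w))
    (hQm : Q.Monic) (hQirr : Irreducible (Q.map (Int.castRingHom ℚ)))
    (hψQ : Polynomial.eval₂ (Int.castRingHom (CategoryTheory.End A)) (ψ : CategoryTheory.End A) Q = 0)
    (hα2 : α ≫ α = Polynomial.eval₂ (Int.castRingHom (CategoryTheory.End A)) (ψ : CategoryTheory.End A) qa)
    (hqa : ∀ z : ℂ, (Q.map (Int.castRingHom ℂ)).IsRoot z → (qa.map (Int.castRingHom ℂ)).eval z ≠ 0)
    (hβ2 : β ≫ β = Polynomial.eval₂ (Int.castRingHom (CategoryTheory.End A)) (ψ : CategoryTheory.End A) qb)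
    (hqb : ∀ z : ℂ, (Q.map (Int.castRingHom ℂ)).IsRoot z → (qb.map (Int.castRingHom ℂ)).eval z ≠ 0)
    (hanti : α ≫ β = -(β ≫ α))
    (hαskew : ∀ v w : complexBetti A.X 1, polarizationPairingOne A.X h (A.dim - 1) (pullbackOne A α v) w =
      -polarizationPairingOne A.X h (A.dim - 1) v (pullbackOne A α w))
    (hβskew : ∀ v w : complexBetti A.X 1, polarizationPairingOne A.X h (A.dim - 1) (pullbackOne A β v) w =
      -polarizationPairingOne A.X h (A.dim - 1) v (pullbackOne A β w))
    (hψα : ψ ≫ α = α ≫ ψ) (hψβ : ψ ≫ β = β ≫ ψ)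
    (hD : ∀ g : A ⟶ A, ∃ N : ℤ, N ≠ 0 ∧ End.of (N • g) ∈ Subring.closure {End.of ψ, End.of α, End.of β})
    (hPm : P.Monic) (hPe : P.natDegree = e) (hPirr : Irreducible (P.map (Int.castRingHom ℚ)))
    (hφ : Polynomial.eval₂ (Int.castRingHom (CategoryTheory.End A)) (φ : CategoryTheory.End A) P = 0)
    (her : e * (2 * m) = 2 * A.dim) :
    weilClassesField A φ P (2 * m) ⊓ divisorClassesSpan A.X A.dim m = ⊥ ↔ ∃ g : A ⟶ A, g ≫ φ ≠ φ ≫ g := by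
  have hm : m ≠ 0 := by
    rintro rfl
    rw [mul_zero, mul_zero] at her
    omega
  rw [weilClassesField_inf_divisorClassesSpan_eq_bot_iff_not_le_divisorClassesSpan hPm hPe hPirr hφ her hm hh hnd,
    weilClassesField_le_divisorClassesSpan_iff_forall_comp_comm_of_definiteQuaternionOver_End hA hh htop hnd hψsym hQm hQirr
      hψQ hα2 hqa hβ2 hqb hanti hαskew hβskew hψα hψβ hD hPm hPe hPirr hφ her, not_forall]

end Central

end Literature.AlgebraicGeometry.HodgeTheory

end
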